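import Mathlib.Analysis.SpecialFunctions.Trigonometric.Bounds
import Mathlib.Topology.Order.IntermediateValue
import HarnessLib

/-!
# Angle recovery: from the recast conclusions `1 - cos u → 0`, `1 - cos u ≤ κ_max < 2` back to the angle

Venture GRIDFUSION, `plan/PARTITION.md` A6 (pole-slip honesty rule: the certified set omits an arc
per relative angle, `κ = 1 - cos u ≤ κ_max < 2`) and A5 (bridge, seat gridfusion-lyap-1); namespace
`Summit.Ventures.GridStability.Lyapunov`. Pure real analysis, no model: the certificate bridge
(`CertificateSoundness.lean`) concludes, in the RECAST coordinates `z = (sin u, 1 - cos u, ω)`, that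
`z t → 0` and that `1 - cos (u t) ≤ κ_max` persists; the two lemmas here turn this into the
sentence in ORIGINAL coordinates that A6 licenses — the relative angle never crosses `±π`
(no pole slip) and returns to `0` (`u = δ - δˢ → 0`):

* `abs_lt_pi_of_neg_one_lt_cos` — **window persistence** (intermediate value theorem): `u`
  continuous on `[0, ∞)`, `|u 0| < π`, `cos (u t) > -1` for all `t ≥ 0` ⇒ `|u t| < π` for all `t ≥ 0`;
* `sq_le_mul_one_sub_cos` — Jordan's inequality in the form `u² ≤ (π²/2)(1 - cos u)` for `|u| ≤ π`;
* `tendsto_zero_of_one_sub_cos_tendsto` — `|u t| < π` on `[0, ∞)` and `1 - cos (u t) → 0` ⇒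
  `u t → 0`; `angle_recovery` packages the three.

MODELLED/CERTIFIED: nothing here; these are the deterministic last step of a «-roa» sentence.
-/

noncomputable section

open Set Filter Topology Real

namespace Summit.Ventures.GridStability.Lyapunov

/-- **Window persistence (no pole slip).** If `u` is continuous on `[0, ∞)`, `|u 0| < π`, and
`cos (u t) > -1` for every `t ≥ 0` (the arc-exclusion bound `1 - cos (u t) ≤ κ_max < 2`), then
`|u t| < π` for every `t ≥ 0`: otherwise `|u|` would take the value `π` at some intermediate time
(intermediate value theorem), where `cos u = -1`. [folklore] -/
theorem abs_lt_pi_of_neg_one_lt_cos {u : ℝ → ℝ} (hu : ContinuousOn u (Ici 0)) (h0 : |u 0| < π)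
    (hcos : ∀ t, 0 ≤ t → -1 < cos (u t)) : ∀ t, 0 ≤ t → |u t| < π := by
  intro t ht
  by_contra hcon
  rw [not_lt] at hcon
  have hcont : ContinuousOn (fun s ↦ |u s|) (Icc 0 t) :=
    (continuous_abs.comp_continuousOn (hu.mono fun s hs ↦ hs.1))
  obtain ⟨s, hs, hsπ⟩ : ∃ s ∈ Icc 0 t, |u s| = π :=
    intermediate_value_Icc ht hcont ⟨h0.le, hcon⟩
  have hcs : cos (u s) = -1 := by
    rcases (abs_eq pi_pos.le).1 hsπ with h | h
    · rw [h, cos_pi]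
    · rw [h, cos_neg, cos_pi]
  have := hcos s hs.1
  rw [hcs] at this
  exact lt_irrefl _ this

/-- **Jordan's inequality, cosine form**: `u² ≤ (π²/2)·(1 - cos u)` for `|u| ≤ π`
(`1 - cos u = 2 sin²(u/2)` and `sin (v/2) ≥ v/π` on `[0, π]`, Mathlib's `Real.mul_le_sin`).
[folklore] -/
theorem sq_le_mul_one_sub_cos {u : ℝ} (hu : |u| ≤ π) : u ^ 2 ≤ π ^ 2 / 2 * (1 - cos u) := by
  -- reduce to `v = |u| ∈ [0, π]`
  set v : ℝ := |u| with hv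
  have hv0 : 0 ≤ v := abs_nonneg u
  have hcosv : cos u = cos v := by rw [hv, cos_abs]
  have hsq : u ^ 2 = v ^ 2 := by rw [hv, sq_abs]
  rw [hcosv, hsq]
  -- `1 - cos v = 2 sin² (v/2)`
  have h1 : 1 - cos v = 2 * sin (v / 2) ^ 2 := by
    have h := cos_sq (v / 2)   -- cos (v/2)^2 = 1/2 + cos (2 * (v/2)) / 2
    rw [show 2 * (v / 2) = v by ring] at h
    nlinarith [sin_sq_add_cos_sq (v / 2)]
  -- Jordan: `2/π · (v/2) ≤ sin (v/2)` on `[0, π/2]`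
  have hj : 2 / π * (v / 2) ≤ sin (v / 2) := mul_le_sin (by positivity) (by linarith)
  have hj' : v / π ≤ sin (v / 2) := by
    have : 2 / π * (v / 2) = v / π := by ring
    rwa [this] at hj
  have hvπ : 0 ≤ v / π := by positivity
  have h2 : (v / π) ^ 2 ≤ sin (v / 2) ^ 2 := pow_le_pow_left₀ hvπ hj' 2
  have hπ : 0 < π := pi_pos
  have h3 : v ^ 2 = π ^ 2 * (v / π) ^ 2 := by field_simp
  rw [h3, h1]
  nlinarith [h2, sq_nonneg π]

/-- **Angle convergence from the recast conclusion**: if `|u t| < π` for all `t ≥ 0` and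
`1 - cos (u t) → 0` as `t → ∞`, then `u t → 0` (squeeze with `sq_le_mul_one_sub_cos`).
[folklore] -/
theorem tendsto_zero_of_one_sub_cos_tendsto {u : ℝ → ℝ} (hwin : ∀ t, 0 ≤ t → |u t| < π)
    (hlim : Tendsto (fun t ↦ 1 - cos (u t)) atTop (𝓝 0)) : Tendsto u atTop (𝓝 0) := by
  -- `u t ^ 2 → 0`
  have hsq : Tendsto (fun t ↦ u t ^ 2) atTop (𝓝 0) := by
    have hg : Tendsto (fun t ↦ π ^ 2 / 2 * (1 - cos (u t))) atTop (𝓝 0) := by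
      simpa using hlim.const_mul (π ^ 2 / 2)
    refine squeeze_zero' (Eventually.of_forall fun t ↦ sq_nonneg (u t)) ?_ hg
    filter_upwards [eventually_ge_atTop (0 : ℝ)] with t ht
    exact sq_le_mul_one_sub_cos (hwin t ht).le
  -- hence `|u t| = √(u t ^ 2) → 0`
  have habs : Tendsto (fun t ↦ |u t|) atTop (𝓝 0) := by
    have h := (continuous_sqrt.tendsto 0).comp hsq
    rw [sqrt_zero] at h
    refine h.congr fun t ↦ ?_
    simp [Function.comp_apply, sqrt_sq_eq_abs]
  exact (tendsto_zero_iff_abs_tendsto_zero u).2 habs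

/-- **Angle recovery, packaged** (A6 «no pole slip, return to synchronism» in original
coordinates): `u` continuous on `[0, ∞)` with `|u 0| < π`, the persistent arc bound
`1 - cos (u t) ≤ κ_max < 2` and `1 - cos (u t) → 0` (both delivered by the certificate bridge on
the recast variable `κ = 1 - cos u`) ⇒ `|u t| < π` for all `t ≥ 0` and `u t → 0`. [folklore] -/
theorem angle_recovery {u : ℝ → ℝ} {κmax : ℝ} (hκ : κmax < 2) (hu : ContinuousOn u (Ici 0))
    (h0 : |u 0| < π) (hbound : ∀ t, 0 ≤ t → 1 - cos (u t) ≤ κmax)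
    (hlim : Tendsto (fun t ↦ 1 - cos (u t)) atTop (𝓝 0)) :
    (∀ t, 0 ≤ t → |u t| < π) ∧ Tendsto u atTop (𝓝 0) := by
  have hwin := abs_lt_pi_of_neg_one_lt_cos hu h0 fun t ht ↦ by linarith [hbound t ht]
  exact ⟨hwin, tendsto_zero_of_one_sub_cos_tendsto hwin hlim⟩

end Summit.Ventures.GridStability.Lyapunov

end
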